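import Literature.Computability.Complexity.PrivateCoinGames
import HarnessLib

/-!
# Private-coin games: the value is invariant under renaming the coins

Trunk T-CPLX-CORE, a small complement to `PrivateCoinGames.lean` (`PCGame`, `opt`): two games
over the same message alphabet whose verifiers agree along a BIJECTION of their coin spaces
(`next' r' = next (φ r')`, `accept' r' ↔ accept (φ r')`) have the same backward-induction value
`opt n h` for every `n`, `h` (`opt_congr_equiv`). Written for the agreement step of the App. D
campaign (the machine verifier's game, whose coins are bit vectors, against the protocol's game,
whose coins are a product of uniform coordinates), but independent of it. All proved, [folklore].

## References

* [AroraBarakCC2009] S. Arora, B. Barak, *Computational Complexity: A Modern Approach*, CUP 2009,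
  §8.1, Def. 8.6.
-/

namespace Literature.Computability.Complexity

namespace PCGame

open Finset

variable {R R' M : Type*} (G : PCGame R M) (G' : PCGame R' M) (φ : R' ≃ R)

/-- **Agreement along a coin bijection**: the second game is the first with coins renamed. [folklore] -/
structure Agrees : Prop where
  next_eq : ∀ r' h, G'.next r' h = G.next (φ r') h
  accept_iff : ∀ r' h, G'.accept r' h ↔ G.accept (φ r') h

variable {G G' φ}

/-- Consistency of coins with a history is preserved by the renaming. [folklore] -/
theorem Agrees.consistent_iff (hA : Agrees G G' φ) (r' : R') (h : List M) :
    G'.Consistent r' h ↔ G.Consistent (φ r') h := by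
  unfold Consistent
  constructor
  · intro hc h₁ a h₂ heq he
    rw [← hA.next_eq]; exact hc h₁ a h₂ heq he
  · intro hc h₁ a h₂ heq he
    rw [hA.next_eq]; exact hc h₁ a h₂ heq he

variable [Fintype R] [Fintype R'] [Fintype M]

open scoped Classical in
/-- **Games agreeing along a coin bijection have the same value.** [folklore] -/
theorem opt_congr_equiv (hA : Agrees G G' φ) : ∀ (n : ℕ) (h : List M), G'.opt n h = G.opt n h
  | 0, h => by
    simp only [opt]
    refine card_bij (fun r' _ => φ r') (fun r' hr => ?_) (fun a _ b _ hab => φ.injective hab)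
      (fun r hr => ⟨φ.symm r, ?_, φ.apply_symm_apply r⟩)
    · rw [mem_filter] at hr ⊢
      exact ⟨mem_univ _, (hA.consistent_iff r' h).1 hr.2.1, (hA.accept_iff r' h).1 hr.2.2⟩
    · rw [mem_filter] at hr ⊢
      refine ⟨mem_univ _, (hA.consistent_iff _ h).2 ?_, (hA.accept_iff _ h).2 ?_⟩
      · rw [φ.apply_symm_apply]; exact hr.2.1
      · rw [φ.apply_symm_apply]; exact hr.2.2
  | n + 1, h => by
    simp only [opt]
    split_ifs
    · exact sum_congr rfl fun a _ => opt_congr_equiv hA n (h ++ [a])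
    · exact congr_arg _ (funext fun b => opt_congr_equiv hA n (h ++ [b]))

end PCGame

end Literature.Computability.Complexity
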